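import Mathlib
import Summits.NavierStokesRegularity.FluidComputer.CertifierNormBounds

/-!
# THEOREM 3-B (a) STEPS 2–3 as an a-priori estimate: bordered head inverse + coercive tail Schur form ⇒ `‖(S₀ w, μ)‖ ≤ M₀‖𝔅′(w, μ)‖`, and the transfer of such a bound under small perturbations (profile-cert-3 g4, cell `ns-blowup`, 2026-08-26)

HONEST FRAMING (human rulings D-0035/D-0074): nothing here is a claim about Navier–Stokes blow-up.
WHAT THIS IS NOT: not NS evidence. Abstract inner-product-space estimates; their consumer is THEOREM
3-B of `instab/CERT-ROPE-X0.md` (REFEREE A19 PASS) for the MODEL operator «forced NS linearised about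
abc(1,1,1)» and the F5 certificate rows of GROUP B (`CertificateAbcSpectrum*`, three implementations).
Companion of `BorderedResolventFredholm.lean` (same seat): there an A-PRIORI BOUND
`‖(S₀ w, μ)‖ ≤ M‖𝔅′(w, μ)‖` for the bordered operator `𝔅′(w, μ) = (R w + μṽ, φ w)` in resolvent
coordinates (`(λ̃ − L)(S₀ w) = R w`, `D(L) = range S₀`) is turned into «`𝔅` bijective, `‖𝔅⁻¹‖ ≤ M`»
by the Fredholm alternative; here the a-priori bound is DERIVED from exactly the data a 3-B row prints.

* §1 `apriori_bound_of_head_tail` — split `H = U ⊕ Uᗮ` by the star projection `P` onto a complete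
  subspace `U` (the cube truncation `Π_{K₀}H`; `ṽ ∈ U`; `S₀` preserves `U` and `Uᗮ`; `φ` vanishes on
  `Uᗮ`). HEAD: a LINEAR left inverse `Ainv` on `U × 𝕜` of the bordered head `(u, μ) ↦ (P R u + μṽ, φ u)`
  (the certified invertible bordered matrix `Â`), with `α ≥ ‖Â⁻¹‖`, `β_B ≥ ‖Â⁻¹B̂‖`, `β_C ≥ ‖ĈÂ⁻¹‖`
  stated in the `v = S₀ w` measure in which the certifiers print them. TAIL: the Schur form is coercive
  against `S₀`, `μ‖S₀ w‖² ≤ Re⟪R w − R (Ainv (P R w, 0)).1, S₀ w⟫` on `Uᗮ` (the certified `MU2_b > 0`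
  after `SkewCutGalerkinTailForm.tail_coercive_of_structure`-type bookkeeping; same shape as
  `SkewCutGalerkinInjectivity.injective_of_head_tail_coercive` with the bordered head). CONCLUSION:
  `‖(S₀ w, μ)‖ ≤ M₀ ‖(R w + μṽ, φ w)‖` for ALL `(w, μ)`, `M₀ = √((1 + β_C²)/μ² + (α + β_B√(1 + β_C²)/μ)²)`
  — literally the printed `M₀` (`CertifierNormBounds.WithLp.norm_le_backSubst_mul_norm`). This is 3-B (a)
  STEPS 2–3 («`‖u_T‖ ≤ (‖f_T‖ + β_C‖f_h‖)/MU2_b`, `‖û_h‖ ≤ α‖f_h‖ + β_B‖u_T‖` … `‖x‖ ≤ M`») read as an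
  ESTIMATE on any solution: no Lax–Milgram / existence statement is involved.
* §1 `apriori_bound_of_head_tail_inner` — the same with `φ = ⟪ṽ, S₀ ·⟫` (its vanishing on `Uᗮ` derived).
* §2 `apriori_bound_of_perturbation` — TRANSFER: if `‖J x‖ ≤ M‖B x‖` for all `x` and
  `‖(B′ − B) x‖ ≤ δ‖J x‖` with `Mδ < 1`, then `‖J x‖ ≤ (M/(1 − Mδ))‖B′ x‖` (K-B6 in the `J`-measure: the
  bound at the float pair `(λ̃, ṽ)` transfers to the bordered operator at the certified pair
  `(λ⋆, v⋆)`, `δ = √2ρ`, `M⋆ = M/(1 − κ)`, and from there to `𝔅⋆_z`, `δ = |z − λ⋆|` — 3-B (c)/(d));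
  `injective_of_apriori_bound` — such a bound with `J = S₀ ⊕ 1`, `S₀` injective, makes `B` injective.

Mathlib + `CertifierNormBounds`; no new definitions. bears_on LADDER-NS N5 / Z4-a(1)(2) (F5 certificate
rigour); evidence-only for route item `EpisodeBase` (stmt-NavierStokesRegularity-19179).
-/

open scoped InnerProductSpace

namespace Summit.NavierStokesRegularity.FluidComputer.BorderedHeadTailBound

variable {𝕜 H : Type*} [RCLike 𝕜] [NormedAddCommGroup H] [InnerProductSpace 𝕜 H]

/-! ## §1 The a-priori bound from head/tail data -/

/-- Pythagoras across `U ⊕ Uᗮ`: `a ∈ U`, `b ∈ Uᗮ` ⇒ `‖a + b‖² = ‖a‖² + ‖b‖²`. [folklore] -/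
theorem norm_add_sq_of_mem_orthogonal (U : Submodule 𝕜 H) {a b : H} (ha : a ∈ U) (hb : b ∈ Uᗮ) :
    ‖a + b‖ ^ 2 = ‖a‖ ^ 2 + ‖b‖ ^ 2 := by
  have h := norm_add_sq_eq_norm_sq_add_norm_sq_of_inner_eq_zero a b
    (Submodule.inner_right_of_mem_orthogonal ha hb)
  simpa [sq] using h

omit [InnerProductSpace 𝕜 H] in
/-- The `ℓ²`-norm of a triple written as a nested pair: `‖((a, b), c)‖² = ‖a‖² + ‖b‖² + ‖c‖²`.
[folklore] -/
theorem norm_toLp_toLp_sq (a c : H) (b : 𝕜) :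
    ‖(WithLp.toLp 2 (WithLp.toLp 2 (a, b), c) : WithLp 2 (WithLp 2 (H × 𝕜) × H))‖ ^ 2 =
      ‖a‖ ^ 2 + ‖b‖ ^ 2 + ‖c‖ ^ 2 := by
  rw [WithLp.prod_norm_sq_eq_of_L2, WithLp.toLp_fst, WithLp.toLp_snd,
    WithLp.prod_norm_sq_eq_of_L2, WithLp.toLp_fst, WithLp.toLp_snd]

omit [InnerProductSpace 𝕜 H] in
/-- `‖(a, b)‖² = ‖a‖² + ‖b‖²` in `H ⊕₂ 𝕜`. [folklore] -/
theorem norm_toLp_sq (a : H) (b : 𝕜) : ‖WithLp.toLp 2 (a, b)‖ ^ 2 = ‖a‖ ^ 2 + ‖b‖ ^ 2 := by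
  rw [WithLp.prod_norm_sq_eq_of_L2, WithLp.toLp_fst, WithLp.toLp_snd]

/-- **THEOREM 3-B (a) STEPS 2–3 as an a-priori estimate (bordered head, coercive tail,
back-substitution).** Let `P` be the star projection onto a complete subspace `U` of the inner product
space `H` (head), `S₀` a bounded operator preserving `U` and `Uᗮ` (the free resolvent is diagonal in
the mode basis), `v ∈ U` the bordering vector, `φ` a linear functional vanishing on `Uᗮ`, `R` bounded
(`= λ̃ − L` in resolvent coordinates). HEAD DATA: a linear `Ainv` on `H × 𝕜` which is a LEFT inverse of
the bordered head on `U × 𝕜`, `Ainv (P (R u) + μ • v, φ u) = (u, μ)` for `u ∈ U`, obeying, in the `v = S₀ w` measure, `‖(S₀ ⊕ 1)(Ainv (y, g))‖ ≤ α‖(y, g)‖`,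
`‖(S₀ ⊕ 1)(Ainv (P (R w), 0))‖ ≤ β_B‖S₀ w‖` for `w ∈ Uᗮ`, and `‖(1 − P)(R (Ainv (y, g)).1)‖ ≤ β_C‖(y, g)‖`
(`y ∈ U`). TAIL DATA: `μ‖S₀ w‖² ≤ Re⟪R w − R (Ainv (P (R w), 0)).1, S₀ w⟫` for `w ∈ Uᗮ`, `μ > 0`.
CONCLUSION: for every `w : H`, `m : 𝕜`,
`‖(S₀ w, m)‖ ≤ √((1 + β_C²)/μ² + (α + β_B√(1 + β_C²)/μ)²) · ‖(R w + m • v, φ w)‖` in `H ⊕₂ 𝕜`.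
Proof: with `f = R w + m•v`, `g = φ w`, `w = w_h + w_T`: the head equation and the left inverse give
`(w_h, m) = Ainv (P f, g) − Ainv (P (R w_T), 0)`, whence the head bound; the Schur form at `w_T`
differs from `(1 − P) f − (1 − P) R (Ainv (P f, g)).1` by a vector of `U`, orthogonal to `S₀ w_T`, whence
`‖S₀ w_T‖ ≤ (‖(1 − P) f‖ + β_C‖(P f, g)‖)/μ`; Pythagoras and `sq_add_sq_le_backSubst` combine them.
[folklore] -/
theorem apriori_bound_of_head_tail (R S₀ : H →L[𝕜] H) (U : Submodule 𝕜 H)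
    [U.HasOrthogonalProjection]
    (hS₀U : ∀ u ∈ U, S₀ u ∈ U) (hS₀U' : ∀ w ∈ Uᗮ, S₀ w ∈ Uᗮ)
    (v : H) (hv : v ∈ U) (φ : H →ₗ[𝕜] 𝕜) (hφ : ∀ w ∈ Uᗮ, φ w = 0)
    (Ainv : (H × 𝕜) →ₗ[𝕜] (H × 𝕜))
    (hAleft : ∀ u ∈ U, ∀ m : 𝕜, Ainv (U.starProjection (R u) + m • v, φ u) = (u, m))
    {α βB βC μ : ℝ} (hμ : 0 < μ) (hα : 0 ≤ α) (hβB : 0 ≤ βB) (hβC : 0 ≤ βC)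
    (hαb : ∀ y ∈ U, ∀ g : 𝕜,
      ‖WithLp.toLp 2 (S₀ (Ainv (y, g)).1, (Ainv (y, g)).2)‖ ≤ α * ‖WithLp.toLp 2 (y, g)‖)
    (hβBb : ∀ w ∈ Uᗮ,
      ‖WithLp.toLp 2 (S₀ (Ainv (U.starProjection (R w), 0)).1,
          (Ainv (U.starProjection (R w), 0)).2)‖ ≤ βB * ‖S₀ w‖)
    (hβCb : ∀ y ∈ U, ∀ g : 𝕜,
      ‖R (Ainv (y, g)).1 - U.starProjection (R (Ainv (y, g)).1)‖ ≤ βC * ‖WithLp.toLp 2 (y, g)‖)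
    (hcoer : ∀ w ∈ Uᗮ, μ * ‖S₀ w‖ ^ 2 ≤
      RCLike.re ⟪R w - R (Ainv (U.starProjection (R w), 0)).1, S₀ w⟫_𝕜)
    (w : H) (m : 𝕜) :
    ‖WithLp.toLp 2 (S₀ w, m)‖ ≤
      √((1 + βC ^ 2) / μ ^ 2 + (α + βB * √(1 + βC ^ 2) / μ) ^ 2) *
        ‖WithLp.toLp 2 (R w + m • v, φ w)‖ := by
  set P := U.starProjection with hP
  -- split `w`
  set wh : H := P w with hwh
  set wT : H := w - P w with hwT
  have hwhU : wh ∈ U := U.starProjection_apply_mem w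
  have hwTU : wT ∈ Uᗮ := U.sub_starProjection_mem_orthogonal w
  have hsplit : w = wh + wT := by rw [hwh, hwT]; abel
  -- data
  set f : H := R w + m • v with hf
  set fh : H := P f with hfh
  set fT : H := f - P f with hfT
  set g : 𝕜 := φ w with hg
  have hfhU : fh ∈ U := U.starProjection_apply_mem f
  have hfTU : fT ∈ Uᗮ := U.sub_starProjection_mem_orthogonal f
  have hgh : φ wh = g := by
    rw [hg, hsplit, map_add, hφ wT hwTU, add_zero]
  have hPv : P v = v := (Submodule.starProjection_eq_self_iff).mpr hv
  -- head identity: `P (R wh) + m • v = fh - P (R wT)`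
  have hhead : P (R wh) + m • v = fh - P (R wT) := by
    rw [hfh, hf, hsplit, map_add, map_add, map_add, map_smul, hPv]; abel
  set A1 := Ainv (fh, g) with hA1
  set A2 := Ainv (P (R wT), 0) with hA2
  have hwm : ((wh, m) : H × 𝕜) = A1 - A2 := by
    have h1 : Ainv ((fh, g) - (P (R wT), (0 : 𝕜))) = A1 - A2 := by rw [map_sub]
    rw [← h1, Prod.mk_sub_mk, sub_zero, ← hhead, ← hgh]
    exact (hAleft wh hwhU m).symm
  have hwh' : wh = A1.1 - A2.1 := by
    have := congrArg Prod.fst hwm; simpa using this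
  have hm' : m = A1.2 - A2.2 := by
    have := congrArg Prod.snd hwm; simpa using this
  -- head bound
  have hH : ‖WithLp.toLp 2 (S₀ wh, m)‖ ≤ α * ‖WithLp.toLp 2 (fh, g)‖ + βB * ‖S₀ wT‖ := by
    have h1 := hαb fh hfhU g
    have h2 := hβBb wT hwTU
    have heq : WithLp.toLp 2 (S₀ wh, m) =
        WithLp.toLp 2 (S₀ A1.1, A1.2) - WithLp.toLp 2 (S₀ A2.1, A2.2) := by
      rw [← WithLp.toLp_sub, Prod.mk_sub_mk, ← map_sub, ← hwh', ← hm']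
    rw [heq]
    exact (norm_sub_le _ _).trans (add_le_add h1 h2)
  -- tail identity: the Schur form at `wT` equals `fT - (1 - P) (R A1.1)` up to a vector of `U`
  have hS₀wT : S₀ wT ∈ Uᗮ := hS₀U' wT hwTU
  have htail : RCLike.re ⟪R wT - R A2.1, S₀ wT⟫_𝕜 =
      RCLike.re ⟪fT - (R A1.1 - P (R A1.1)), S₀ wT⟫_𝕜 := by
    have hA2eq : A2.1 = A1.1 - wh := by rw [hwh']; abel
    have hRA2 : R A2.1 = R A1.1 - R wh := by rw [hA2eq, map_sub]
    have hRw : R w = R wh + R wT := by rw [← map_add, ← hsplit]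
    have hdiff : (R wT - R A2.1) - (fT - (R A1.1 - P (R A1.1))) =
        P f - P (R A1.1) - m • v := by
      rw [hRA2, hfT, hf, hRw]
      abel
    have hdiffU : (R wT - R A2.1) - (fT - (R A1.1 - P (R A1.1))) ∈ U := by
      rw [hdiff]
      exact U.sub_mem (U.sub_mem (U.starProjection_apply_mem _) (U.starProjection_apply_mem _))
        (U.smul_mem m hv)
    have h0 : ⟪(R wT - R A2.1) - (fT - (R A1.1 - P (R A1.1))), S₀ wT⟫_𝕜 = 0 :=
      Submodule.inner_right_of_mem_orthogonal hdiffU hS₀wT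
    rw [inner_sub_left, sub_eq_zero] at h0
    rw [h0]
  -- tail bound
  have hTb : ‖S₀ wT‖ ≤ (‖fT‖ + βC * ‖WithLp.toLp 2 (fh, g)‖) / μ := by
    have hc := hcoer wT hwTU
    rw [htail] at hc
    have hcs : RCLike.re ⟪fT - (R A1.1 - P (R A1.1)), S₀ wT⟫_𝕜 ≤
        ‖fT - (R A1.1 - P (R A1.1))‖ * ‖S₀ wT‖ := re_inner_le_norm _ _
    have hn : ‖fT - (R A1.1 - P (R A1.1))‖ ≤ ‖fT‖ + βC * ‖WithLp.toLp 2 (fh, g)‖ :=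
      (norm_sub_le _ _).trans (add_le_add le_rfl (hβCb fh hfhU g))
    have hpos : 0 ≤ ‖fT‖ + βC * ‖WithLp.toLp 2 (fh, g)‖ := by positivity
    rw [le_div_iff₀ hμ]
    have h3 : μ * ‖S₀ wT‖ ^ 2 ≤ (‖fT‖ + βC * ‖WithLp.toLp 2 (fh, g)‖) * ‖S₀ wT‖ :=
      hc.trans (hcs.trans (mul_le_mul_of_nonneg_right hn (norm_nonneg _)))
    by_cases hs : ‖S₀ wT‖ = 0
    · rw [hs, zero_mul]; exact hpos
    · have hs' : 0 < ‖S₀ wT‖ := lt_of_le_of_ne (norm_nonneg _) (Ne.symm hs)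
      rw [pow_two, ← mul_assoc] at h3
      rw [mul_comm]
      exact le_of_mul_le_mul_right h3 hs'
  -- back-substitution in the ℓ²-product norm
  have key := CertifierNormBounds.WithLp.norm_le_backSubst_mul_norm
    (WithLp.toLp 2 (WithLp.toLp 2 (fh, g), fT) : WithLp 2 (WithLp 2 (H × 𝕜) × H))
    (WithLp.toLp 2 (WithLp.toLp 2 (S₀ wh, m), S₀ wT) : WithLp 2 (WithLp 2 (H × 𝕜) × H))
    hμ hα hβB hβC hTb hH
  -- identify the norms (Pythagoras across `U ⊕ Uᗮ`)
  have hS₀whU : S₀ wh ∈ U := hS₀U wh hwhU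
  have hS₀w : S₀ w = S₀ wh + S₀ wT := by rw [← map_add, ← hsplit]
  have hy' : ‖(WithLp.toLp 2 (WithLp.toLp 2 (S₀ wh, m), S₀ wT) : WithLp 2 (WithLp 2 (H × 𝕜) × H))‖
      = ‖WithLp.toLp 2 (S₀ w, m)‖ := by
    have h1 : ‖(WithLp.toLp 2 (WithLp.toLp 2 (S₀ wh, m), S₀ wT) :
        WithLp 2 (WithLp 2 (H × 𝕜) × H))‖ ^ 2 = ‖WithLp.toLp 2 (S₀ w, m)‖ ^ 2 := by
      rw [norm_toLp_toLp_sq, norm_toLp_sq, hS₀w, norm_add_sq_of_mem_orthogonal U hS₀whU hS₀wT]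
      ring
    exact (pow_left_inj₀ (norm_nonneg _) (norm_nonneg _) two_ne_zero).mp h1
  have hfsplit : f = fh + fT := by rw [hfh, hfT]; abel
  have hx' : ‖(WithLp.toLp 2 (WithLp.toLp 2 (fh, g), fT) : WithLp 2 (WithLp 2 (H × 𝕜) × H))‖
      = ‖WithLp.toLp 2 (f, g)‖ := by
    have h1 : ‖(WithLp.toLp 2 (WithLp.toLp 2 (fh, g), fT) :
        WithLp 2 (WithLp 2 (H × 𝕜) × H))‖ ^ 2 = ‖WithLp.toLp 2 (f, g)‖ ^ 2 := by
      rw [norm_toLp_toLp_sq, norm_toLp_sq, hfsplit, norm_add_sq_of_mem_orthogonal U hfhU hfTU]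
      ring
    exact (pow_left_inj₀ (norm_nonneg _) (norm_nonneg _) two_ne_zero).mp h1
  rw [← hy', ← hx']
  exact key

/-- `⟪v, S₀ w⟫ = 0` for `v ∈ U`, `w ∈ Uᗮ` when `S₀` preserves `Uᗮ` — the functional `φ = ⟪ṽ, S₀ ·⟫`
of the bordered operator vanishes on the tail. [folklore] -/
theorem inner_apply_eq_zero_of_mem_orthogonal (S₀ : H →L[𝕜] H) (U : Submodule 𝕜 H)
    (hS₀U' : ∀ w ∈ Uᗮ, S₀ w ∈ Uᗮ) {v : H} (hv : v ∈ U) {w : H} (hw : w ∈ Uᗮ) :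
    ⟪v, S₀ w⟫_𝕜 = 0 :=
  Submodule.inner_right_of_mem_orthogonal hv (hS₀U' w hw)

/-- **3-B (a) STEPS 2–3, a-priori estimate with the 3-B functional `φ = ⟪ṽ, S₀ ·⟫`** (the
normalisation `⟨v, ṽ⟩` of CERT-ROPE-X0 §B in resolvent coordinates `v = S₀ w`): same hypotheses and
conclusion as `apriori_bound_of_head_tail`, the vanishing of `φ` on `Uᗮ` being automatic. [folklore] -/
theorem apriori_bound_of_head_tail_inner (R S₀ : H →L[𝕜] H) (U : Submodule 𝕜 H)
    [U.HasOrthogonalProjection]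
    (hS₀U : ∀ u ∈ U, S₀ u ∈ U) (hS₀U' : ∀ w ∈ Uᗮ, S₀ w ∈ Uᗮ)
    (v : H) (hv : v ∈ U) (Ainv : (H × 𝕜) →ₗ[𝕜] (H × 𝕜))
    (hAleft : ∀ u ∈ U, ∀ m : 𝕜, Ainv (U.starProjection (R u) + m • v, ⟪v, S₀ u⟫_𝕜) = (u, m))
    {α βB βC μ : ℝ} (hμ : 0 < μ) (hα : 0 ≤ α) (hβB : 0 ≤ βB) (hβC : 0 ≤ βC)
    (hαb : ∀ y ∈ U, ∀ g : 𝕜,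
      ‖WithLp.toLp 2 (S₀ (Ainv (y, g)).1, (Ainv (y, g)).2)‖ ≤ α * ‖WithLp.toLp 2 (y, g)‖)
    (hβBb : ∀ w ∈ Uᗮ,
      ‖WithLp.toLp 2 (S₀ (Ainv (U.starProjection (R w), 0)).1,
          (Ainv (U.starProjection (R w), 0)).2)‖ ≤ βB * ‖S₀ w‖)
    (hβCb : ∀ y ∈ U, ∀ g : 𝕜,
      ‖R (Ainv (y, g)).1 - U.starProjection (R (Ainv (y, g)).1)‖ ≤ βC * ‖WithLp.toLp 2 (y, g)‖)
    (hcoer : ∀ w ∈ Uᗮ, μ * ‖S₀ w‖ ^ 2 ≤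
      RCLike.re ⟪R w - R (Ainv (U.starProjection (R w), 0)).1, S₀ w⟫_𝕜)
    (w : H) (m : 𝕜) :
    ‖WithLp.toLp 2 (S₀ w, m)‖ ≤
      √((1 + βC ^ 2) / μ ^ 2 + (α + βB * √(1 + βC ^ 2) / μ) ^ 2) *
        ‖WithLp.toLp 2 (R w + m • v, ⟪v, S₀ w⟫_𝕜)‖ :=
  apriori_bound_of_head_tail R S₀ U hS₀U hS₀U' v hv ((innerₛₗ 𝕜 v).comp S₀.toLinearMap)
    (fun _ hw => inner_apply_eq_zero_of_mem_orthogonal S₀ U hS₀U' hv hw) Ainv hAleft hμ hα hβB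
    hβC hαb hβBb hβCb hcoer w m

/-! ## §2 Transfer of an a-priori bound under a small perturbation; injectivity -/

section Transfer

variable {X Y Z : Type*} [SeminormedAddCommGroup Y] [SeminormedAddCommGroup Z]

/-- **K-B6 in the `J`-measure (transfer of the a-priori bound).** If `‖J x‖ ≤ M‖B x‖` for all `x`
(`M ≥ 0`) and `B′` differs from `B` by at most `δ` in the `J`-measure, `‖B′ x − B x‖ ≤ δ‖J x‖`, with
`Mδ < 1`, then `‖J x‖ ≤ (M/(1 − Mδ))‖B′ x‖` for all `x`. In 3-B: `J = S₀ ⊕ 1` (the unknown measured by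
`v = S₀ w`), `B = 𝔅′` at the float pair, `B′ = 𝔅⋆′` at the certified pair with `δ = √2ρ` (`Mδ = κ`),
giving `M⋆ = M/(1 − κ)` (3-B (c)); then `B = 𝔅⋆′`, `B′ = 𝔅⋆′_z` with `δ = |z − λ⋆| < 1/M⋆` (3-B (d)).
Only the three functions are used, no linearity. [folklore] -/
theorem apriori_bound_of_perturbation (J : X → Y) (B B' : X → Z) {M δ : ℝ} (hM : 0 ≤ M)
    (hB : ∀ x, ‖J x‖ ≤ M * ‖B x‖) (hP : ∀ x, ‖B' x - B x‖ ≤ δ * ‖J x‖) (hδ : M * δ < 1) (x : X) :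
    ‖J x‖ ≤ M / (1 - M * δ) * ‖B' x‖ := by
  have h1 : ‖B x‖ ≤ ‖B' x‖ + δ * ‖J x‖ := by
    have : B x = B' x - (B' x - B x) := by abel
    rw [this]
    exact (norm_sub_le _ _).trans (add_le_add le_rfl (hP x))
  have h2 : ‖J x‖ ≤ M * ‖B' x‖ + M * δ * ‖J x‖ := by
    calc ‖J x‖ ≤ M * ‖B x‖ := hB x
      _ ≤ M * (‖B' x‖ + δ * ‖J x‖) := mul_le_mul_of_nonneg_left h1 hM
      _ = M * ‖B' x‖ + M * δ * ‖J x‖ := by ring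
  have hpos : 0 < 1 - M * δ := sub_pos.mpr hδ
  rw [div_mul_eq_mul_div, le_div_iff₀ hpos]
  nlinarith [norm_nonneg (B' x)]

end Transfer

/-- **Injectivity from the a-priori bound.** If `‖(S₀ w, μ)‖ ≤ M‖B (w, μ)‖` for all `(w, μ)` and `S₀`
is injective, then `B (w, μ) = 0` forces `(w, μ) = 0` — the injectivity consumed by
`BorderedResolventFredholm.isUnit_bordered_of_injective` and, at the certified pair / at `z`, by
K-B1–K-B3 (`BorderedEigenpairCertificate`). [folklore] -/
theorem eq_zero_of_apriori_bound {Z : Type*} [SeminormedAddCommGroup Z] (S₀ : H →L[𝕜] H)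
    (hS₀ : Function.Injective S₀) (B : H → 𝕜 → Z) {M : ℝ}
    (hB : ∀ w μ, ‖WithLp.toLp 2 (S₀ w, μ)‖ ≤ M * ‖B w μ‖) (w : H) (μ : 𝕜) (h : B w μ = 0) :
    w = 0 ∧ μ = 0 := by
  have h1 := hB w μ
  rw [h, norm_zero, mul_zero] at h1
  have h2 : WithLp.toLp 2 (S₀ w, μ) = 0 := norm_le_zero_iff.mp h1
  have h3 : S₀ w = 0 ∧ μ = 0 := by
    have := congrArg WithLp.ofLp h2
    simpa [Prod.ext_iff] using this
  exact ⟨hS₀ (by rw [h3.1, map_zero]), h3.2⟩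

end Summit.NavierStokesRegularity.FluidComputer.BorderedHeadTailBound
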